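import Summits.QuantumFields.BalabanUV.T4Continuum.Support.NE9BridgeSizeInduction
import Summits.QuantumFields.BalabanUV.T4Continuum.Support.NE9PencilEndSharpVacuum

/-!
# NE9VacuumSubtractedBridgeSharp — END #1's vacuum-subtracted bridge RE-THREADED at the record-level table constant `c_eff = 2`:
# the binder (L) with its table half on the owner's stadium bound (`8·clip·B₀ + (2·B₀/(R₀ − s₀))·qT`; END #1: `8·clip·B₀ + 8·lip·B₀·qT`),
# the coupling-two-point END with (L) DERIVED at rate `ω + (2·B/(R₀ − s₀))·τ̄` (END #1: `ω + 8·lipbar·B·τ̄`, `lipbar = 4/(R₀ − s₀)` today),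
# its occupation-DERIVED form (the twin of `NE9BridgeSizeInduction` §3), and the junction at the record's new-term map `ΨOf`

Cell `pub-balaban`, T4-DAG §6 row NE9; NE9 crux team (coordinator ruling «YM REDIRECT» e34b3e0c (2)), leaf lineage
`b2b-balaban-t4-ne9-formalise-leaf-06` generation 39; route R3′ «pencil ∕ potential-KPG» of `t4/ROUTES-NE9.md` v6∕v7.  CONTEXT: the refuter's
finding F-v8-1 and §C(C8-3) of `PRICING-NE9.md` v8 752d1ffb4e05744c (journal l.29134 ∕ l.29176) — at the record the new term is VACUUM-SUBTRACTED
(`NE9EndApplied.ΨOf = Re newTerm_U − Re newTerm_{U₀} + explZ`) and route R3′'s table Lipschitz constant is `c_eff = 32` today (END #1 =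
`NE9VacuumSubtractedBridge` ∕ `NE9BridgeSizeInduction` §3 ∘ p248329's `TwoPointKP`, `8 = 2` backgrounds `× 4`), `8` through the sibling
`NE9TwoPointKPOfPencilSharp`, `2` at the kernel floor.  The OWNER (lineage `t4-ne9-p1` gen 60) put the floor in the tree on the POTENTIAL-KPG path:
`NE9PencilEndSharp` p256040 (the refuter's stadium engine, constant 1 per cluster sum) and `NE9PencilEndSharpVacuum` p256132
(`outputLipschitz_of_potentialKPG_sharp_vac` at `2·B₀/(R₀ − s₀)`, the END `…_perStep_sharp_vac` with the coupling half `hlast : LastCouplingLipschitz …`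
and the occupation `hocc` DISPLAYED, and the `ΨOf` junction) — his LANDED line l.29227: «`hlast` via `NE9VacuumSubtractedBridge` §2: noted for the
successor (coupling half, by name)».  THIS FILE is that successor piece, END #1's own architecture at the floor (journal INTENT 2 l.29225): the
coupling half DERIVED from END #1's displayed COUPLING TWO-POINT data (`hCup`, `hTcup`, `TwoPointKP`'s majorant `n` — constant `4·clip` per
background, unchanged) with the TABLE half of (L) on the owner's stadium bound, the END with `ℓ = 8·clipbar·B + 2·B/(R₀ − s₀)·qTbar` explicit,
and the occupation DERIVED from END #1's size-induction data — `outputLipschitz_of_potentialKPG_sharp_vac` (p256132 §1) and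
`NE9BridgeSizeInduction.termSize_of_recursion_vacSub` imported BY NAME, nothing restated.  `TwoPointKP`'s `lip` enters NO constant any more; the
added displays against END #1 are the pencil binder `hKP : PotentialKPG W act m a d R₀` (∀ background ⇒ the `U₀` bound needs no new instance
clause — refuter C8-3), the room `hsR : s₀ < R₀`, and the occupancy inclusion `h𝒜 : 𝒜 k ⊆ closedBall 0 s₀` (at the record `admOf … ⊆ closedBall 0 s₀`,
the refuter's «modulo the occupancy inclusion»; displayed, discharged by nobody here).

HONEST FRAMING (T4-DAG PAGE 1).  Rung (B)+1 of the FINITE-VOLUME T⁴ programme — NOT infinite volume, NOT a mass gap, NOT the Clay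
problem.  NE9 (`T4OutputRate.NE9` ∧ `FadingMemory`) is a cell NEW ESTIMATE, NOT PRINTED in [I] = [Balaban1987RG1] (CMP **109**), [II] =
[Balaban1988RG2Cluster] (CMP **116**), and NOT PROVED for Bałaban's E^{(j)} («NE9 ⇐ the named binders»; row WALLED ON A MODEL O-NE9-1; spine
PROVED 0∕9); a sharper constant in a CONDITIONAL END is not progress on the estimate itself.  HONEST DEPENDENCY (cell line, verbatim):
continuum YM on T⁴ ⇐ BetaPertH ∧ nine spine estimates (0/9 proved); BetaPertH ⇐ (D1) ∧ (D4) ∧ CAP+tail; G-an2-4 gates asym, D1 and NE2/3/4.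
`FlowStep.BetaPertH`, (B), (B^μ) do not occur.  Bookkeeping over ABSTRACT carriers and the tree's own KP ∕ cluster-expansion lemmas; no `def`,
no Prop-valued definition, no estimate of any object of the series; [I]∕[II] are referred to for TYPES only (ABSOLUTE RULE).  0 sorry.

* §1 [folklore] **`lastCouplingLipschitz_of_couplingTwoPoint_vacSub_sharp`** — END #1's (L) lemma with the table half at the stadium constant:
  `LastCouplingLipschitz E W T Ψ κ (fun k ↦ 8·clip k·B₀ k + 2·B₀ k/(R₀ − s₀)·qT k)`.
* §2 [folklore] **`ne9_and_fadingMemory_of_couplingTwoPoint_vacSub_sharp`** — `NE9VacuumSubtractedBridge.ne9_and_fadingMemory_of_couplingTwoPoint_vacSub`'s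
  binder list VERBATIM plus (`hKP`, `hsR`, `h𝒜`), `hlipb`∕`lipbar` GONE, `hpos` re-lettered ⊢ NE9 with the product moduli
  `ℓ = 8·clipbar·B + 2·B/(R₀ − s₀)·qTbar`, rate `ω + 2·B/(R₀ − s₀)·τ̄`, and `FadingMemory` of the same rate (§1 + p256132 §1 ∘
  `outerLipschitz_of_factorisation` ∘ `ne9_and_fadingMemory_of_perStepNN`); fading iff `2·B·τ̄ < (R₀ − s₀)(1 − ω)` is p256132's `fade_iff_room_sharp_vac`.
* §3 [folklore] **`ne9_and_fadingMemory_of_couplingTwoPoint_vacSub_sizeInduction_sharp`** — the same with the occupation DERIVED from END #1's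
  size-induction data (B0) `hbase`, (XZ) `hexplZ`, (N′) `hNsucc : p₀ j + 2B ≤ N (j+1)`, `hNnn`, (R′) `hbox`; returns `TermSize E W κ N` too.
* §4 [folklore] **`ne9_and_fadingMemory_of_couplingTwoPoint_vacSub_sizeInduction_psiOf`** — §3 at the record's new-term map
  `Ψ := NE9EndApplied.ΨOf G act wt U₀ explZ`, reading `readingρ wt`, `hreprV` discharged by `rfl` (the twin of p256132's `…_potentialKPG_psiOf`
  with the coupling half and the occupation derived).
DISGUISE TEST: two backgrounds, one table, generic KP cluster sums along a complex pencil; no history beyond the displayed binders; not NE9.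
WHAT THIS DOES NOT DO: touches no activity, no species, no estimate of Bałaban's; `TwoPointKP`∕`hCup`∕`hTcup`∕`PotentialKPG`∕decay∕pin budget∕
reading∕the size data stay DISPLAYED; the model O-NE9-1 (the instance of `act`∕`T`∕`Adm` on Bałaban's carriers), (R-0)[scope] and the coupling
two-point data themselves are untouched; the display `z = p̄₀/B` still decides the refuter's comparison with R4 (PRICING-NE9 v8 §C′: at `c_eff = 2`
alive at print's box iff `z > 4/11`).

References (TYPES only): [Balaban1987RG1] T. Bałaban, CMP **109** (1987) 249–301 — (1.18) p. 263, (2.12)–(2.14) p. 268; [Balaban1988RG2Cluster]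
T. Bałaban, CMP **116** (1988) 1–22 — (1.36) p. 9, (2.14)–(2.15) p. 15, Lemma 3 (2.38) p. 20, (2.40)–(2.41) p. 21; [KoteckyPreiss1986] CMP **103**
(1986) 491–498.  Summits-side NEW work (LEAN PLACEMENT RULE); imports `NE9BridgeSizeInduction` and `NE9PencilEndSharpVacuum` (owner lineage)
BY NAME; modifies nothing; 0 sorry.  Value = END #1's own architecture at the record-level table constant `32 ↦ 2` with the coupling half and
the occupation derived, NOT summit progress.  Engine credit: t4-ne9-refuter gen 7∕8 (stadium bound; PART C recipe C8-3); owner g60 (p256040∕p256132).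
-/

noncomputable section

namespace Summit.QuantumFields.BalabanUV.T4Continuum.NE9VacuumSubtractedBridgeSharp

open scoped BigOperators ENNReal
open Metric Set
open Literature.Probability.LatticeModels
open Literature.MathematicalPhysics.QuantumFieldTheory.Balaban1983to89
open Literature.MathematicalPhysics.QuantumFieldTheory.Balaban1983to89.T4OutputRate
open Literature.MathematicalPhysics.QuantumFieldTheory.Balaban1983to89.T4ActivityLipschitz
open Literature.MathematicalPhysics.QuantumFieldTheory.Balaban1983to89.T4HistoryLipschitzRecursion
open Literature.MathematicalPhysics.QuantumFieldTheory.Balaban1983to89.T4HistoryLipschitzOuter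
open Literature.MathematicalPhysics.QuantumFieldTheory.Balaban1983to89.T4HistoryLipschitzActivity
open Literature.MathematicalPhysics.QuantumFieldTheory.Balaban1983to89.T4HistoryLipschitzActivity (ClusterGeom)
open Literature.MathematicalPhysics.QuantumFieldTheory.Balaban1983to89.T4HistoryLipschitzSegment
open Summit.QuantumFields.BalabanUV.T4Continuum.NE9LastCouplingBridge
open Summit.QuantumFields.BalabanUV.T4Continuum.NE9VacuumSubtractedBridge
open Summit.QuantumFields.BalabanUV.T4Continuum.NE9BridgeSizeInduction
open Summit.QuantumFields.BalabanUV.T4Continuum.NE9PencilEndSharp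
open Summit.QuantumFields.BalabanUV.T4Continuum.NE9PencilEndSharpVacuum

section Bridge

variable {C : Carriers} (G : ClusterGeom C) {Bg : Type} {Pot : Type*} [NormedAddCommGroup Pot] [NormedSpace ℂ Pot]

/-! ## §1 The binder (L) under the vacuum-subtracted representation, table half at the stadium constant -/

/-- [folklore] **`LastCouplingLipschitz` WITH THE VACUUM SUBTRACTION, TABLE HALF AT CONSTANT 1** — END #1's
`NE9VacuumSubtractedBridge.lastCouplingLipschitz_of_couplingTwoPoint_vacSub` with the configuration part re-run on the owner's stadium bound:
COUPLING TWO-POINT (`hCup`, with `TwoPointKP`'s majorant `n` on `𝒜 k`; constant `4·clip` per background, unchanged) ∧ CHANNEL COUPLING MODULUS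
(`hTcup`) ∧ the pencil binder `PotentialKPG` ∧ room ∧ `𝒜 k ⊆ closedBall 0 s₀` ∧ decay ∧ pin budget ∧ reading law ∧ occupation ∧ `hreprV` ⇒
`LastCouplingLipschitz E W T Ψ κ (fun k ↦ 8·clip k·B₀ k + 2·B₀ k/(R₀ − s₀)·qT k)` (the tree's: `… + 8·lip k·B₀ k·qT k`).  The coupling-free part
`explZ` CANCELS. -/
theorem lastCouplingLipschitz_of_couplingTwoPoint_vacSub_sharp {ι : Type} {E : Functional C Bg} {W : Set (ℕ → ℝ)}
    {T : ℕ → (ℕ → ℝ) → (Bg → C.Dom → ℝ) → ι → ℝ} {Ψ : ℕ → ℝ → (ι → ℝ) → Bg → C.Dom → ℝ}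
    {act : ℕ → ℝ → Bg → Pot → G.P → ℂ} {𝒜 : ℕ → Set Pot} {n m : ℕ → ℝ → Bg → G.P → ℝ} {lip clip : ℕ → ℝ}
    {a d : G.P → ℝ} {δ : C.Dom → ℝ} {B₀ qT : ℕ → ℝ} {κ s₀ R₀ : ℝ} {wt : ℕ → ι → ℝ} (ρ : ℕ → (ι → ℝ) → Pot) (U₀ : Bg)
    (explZ : ℕ → Bg → C.Dom → ℝ) (hK : TwoPointKP G W act 𝒜 n lip a d) (hKP : G.PotentialKPG W act m a d R₀)
    (hsR : s₀ < R₀) (h𝒜 : ∀ k, 𝒜 k ⊆ closedBall (0 : Pot) s₀) (hclip0 : ∀ k, 0 ≤ clip k)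
    (hCup : ∀ g ∈ W, ∀ g' ∈ W, ∀ (k : ℕ) (U : Bg) (X : C.Dom), C.scale X = k + 1 → ∀ Q ∈ 𝒜 k, ∀ γ ∈ G.vol X,
      ‖act k (g k) U Q γ‖ ≤ n k (g' k) U γ ∧
        ‖act k (g k) U Q γ - act k (g' k) U Q γ‖ ≤ clip k * |g k - g' k| * n k (g' k) U γ)
    (hdec : G.DecayExtract δ d) (hpin : G.PinBudget a δ B₀ κ)
    (hρ : ∀ (k : ℕ) (P P' : ι → ℝ) (M : ℝ), (∀ y, |P y - P' y| ≤ wt k y * M) → ‖ρ k P - ρ k P'‖ ≤ M)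
    (hreprV : ∀ (k : ℕ) (s : ℝ) (P : ι → ℝ) (U : Bg) (X : C.Dom),
      Ψ k s P U X = (G.newTerm act k s U X (ρ k P)).re - (G.newTerm act k s U₀ X (ρ k P)).re + explZ k U X)
    (hqT0 : ∀ k, 0 ≤ qT k)
    (hTcup : ∀ g ∈ W, ∀ g' ∈ W, ∀ (k : ℕ) (y : ι), |T k g (E g) y - T k g' (E g) y| ≤ wt k y * (qT k * |g k - g' k|))
    (hocc : ∀ g ∈ W, ∀ g' ∈ W, ∀ k : ℕ, ρ k (T k g' (E g)) ∈ 𝒜 k) :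
    LastCouplingLipschitz E W T Ψ κ (fun k => 8 * clip k * B₀ k + 2 * B₀ k / (R₀ - s₀) * qT k) := by
  obtain ⟨ha, hd, hP⟩ := hKP
  intro g hg g' hg' k U X hX
  set P : ι → ℝ := T k g (E g)
  set P' : ι → ℝ := T k g' (E g)
  have hQ : ρ k P ∈ 𝒜 k := hocc g hg g hg k
  have hQ' : ρ k P' ∈ 𝒜 k := hocc g hg g' hg' k
  have hQn : ‖ρ k P‖ ≤ s₀ := mem_closedBall_zero_iff.1 (h𝒜 k hQ)
  have hQ'n : ‖ρ k P'‖ ≤ s₀ := mem_closedBall_zero_iff.1 (h𝒜 k hQ')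
  have ha0 : 0 ≤ a (G.pin X) := ha _
  have hclip0k : 0 ≤ clip k := hclip0 k
  have hqT0k : 0 ≤ qT k := hqT0 k
  have hϱ : 0 < R₀ - s₀ := sub_pos.mpr hsR
  have henv := hpin k X hX
  have hΔ : 0 ≤ |g k - g' k| := abs_nonneg _
  -- (i) same configuration, two couplings, at any background V (END #1's coupling two-point, unchanged)
  have h1 : ∀ V : Bg, ‖G.newTerm act k (g k) V X (ρ k P) - G.newTerm act k (g' k) V X (ρ k P)‖ ≤
      Real.exp (-(κ * C.d X)) * (4 * clip k * B₀ k * |g k - g' k|) := by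
    intro V
    have hnt := norm_newTerm_sub_le_of_couplingTwoPoint G hK hclip0 hCup hdec hg hg' hX (U := V) hQ
    calc ‖G.newTerm act k (g k) V X (ρ k P) - G.newTerm act k (g' k) V X (ρ k P)‖
        ≤ 4 * (clip k * |g k - g' k|) * a (G.pin X) * Real.exp (-(δ X)) := hnt
      _ = 4 * clip k * |g k - g' k| * (a (G.pin X) * Real.exp (-(δ X))) := by ring
      _ ≤ 4 * clip k * |g k - g' k| * (B₀ k * Real.exp (-(κ * C.d X))) :=
          mul_le_mul_of_nonneg_left henv (by positivity)
      _ = Real.exp (-(κ * C.d X)) * (4 * clip k * B₀ k * |g k - g' k|) := by ring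
  -- (ii) same coupling g′ k, two occurring configurations, at any background V — THE STADIUM BOUND (constant 1)
  have hdist : ‖ρ k P - ρ k P'‖ ≤ qT k * |g k - g' k| :=
    hρ k P P' (qT k * |g k - g' k|) fun y => hTcup g hg g' hg' k y
  have h2 : ∀ V : Bg, ‖G.newTerm act k (g' k) V X (ρ k P) - G.newTerm act k (g' k) V X (ρ k P')‖ ≤
      Real.exp (-(κ * C.d X)) * (B₀ k / (R₀ - s₀) * qT k * |g k - g' k|) := by
    intro V
    obtain ⟨hhol, hmaj, hkp⟩ := hP g' hg' k V X hX
    have hnt := norm_clusterSum_sub_le_of_ballKPG_sharp (inc := G.inc) (w := fun Q => act k (g' k) V Q) ha hd hsR hhol hmaj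
      hkp (G.pin_mem X) (G.clus_sub X) (G.clus_pin X) (hdec X) hQn hQ'n
    have hB0 : 0 ≤ (B₀ k * Real.exp (-(κ * C.d X))) / (R₀ - s₀) :=
      div_nonneg ((mul_nonneg ha0 (Real.exp_nonneg _)).trans henv) hϱ.le
    calc ‖G.newTerm act k (g' k) V X (ρ k P) - G.newTerm act k (g' k) V X (ρ k P')‖
        ≤ (a (G.pin X) * Real.exp (-(δ X))) / (R₀ - s₀) * ‖ρ k P - ρ k P'‖ := hnt
      _ ≤ (B₀ k * Real.exp (-(κ * C.d X))) / (R₀ - s₀) * (qT k * |g k - g' k|) :=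
          mul_le_mul (div_le_div_of_nonneg_right henv hϱ.le) hdist (norm_nonneg _) hB0
      _ = Real.exp (-(κ * C.d X)) * (B₀ k / (R₀ - s₀) * qT k * |g k - g' k|) := by ring
  -- combine: at U and at U₀, couplings then configurations
  have h3 : ∀ V : Bg, ‖G.newTerm act k (g k) V X (ρ k P) - G.newTerm act k (g' k) V X (ρ k P')‖ ≤
      Real.exp (-(κ * C.d X)) * ((4 * clip k * B₀ k + B₀ k / (R₀ - s₀) * qT k) * |g k - g' k|) := by
    intro V
    calc ‖G.newTerm act k (g k) V X (ρ k P) - G.newTerm act k (g' k) V X (ρ k P')‖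
        ≤ ‖G.newTerm act k (g k) V X (ρ k P) - G.newTerm act k (g' k) V X (ρ k P)‖ +
            ‖G.newTerm act k (g' k) V X (ρ k P) - G.newTerm act k (g' k) V X (ρ k P')‖ := norm_sub_le_norm_sub_add_norm_sub _ _ _
      _ ≤ Real.exp (-(κ * C.d X)) * (4 * clip k * B₀ k * |g k - g' k|) +
            Real.exp (-(κ * C.d X)) * (B₀ k / (R₀ - s₀) * qT k * |g k - g' k|) := add_le_add (h1 V) (h2 V)
      _ = Real.exp (-(κ * C.d X)) * ((4 * clip k * B₀ k + B₀ k / (R₀ - s₀) * qT k) * |g k - g' k|) := by ring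
  rw [hreprV k (g k) P U X, hreprV k (g' k) P' U X]
  calc |(G.newTerm act k (g k) U X (ρ k P)).re - (G.newTerm act k (g k) U₀ X (ρ k P)).re + explZ k U X -
          ((G.newTerm act k (g' k) U X (ρ k P')).re - (G.newTerm act k (g' k) U₀ X (ρ k P')).re + explZ k U X)|
      = |(G.newTerm act k (g k) U X (ρ k P) - G.newTerm act k (g' k) U X (ρ k P')).re -
          (G.newTerm act k (g k) U₀ X (ρ k P) - G.newTerm act k (g' k) U₀ X (ρ k P')).re| := by
        rw [Complex.sub_re, Complex.sub_re]; ring_nf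
    _ ≤ ‖G.newTerm act k (g k) U X (ρ k P) - G.newTerm act k (g' k) U X (ρ k P')‖ +
          ‖G.newTerm act k (g k) U₀ X (ρ k P) - G.newTerm act k (g' k) U₀ X (ρ k P')‖ := abs_re_sub_re_le _ _
    _ ≤ Real.exp (-(κ * C.d X)) * ((4 * clip k * B₀ k + B₀ k / (R₀ - s₀) * qT k) * |g k - g' k|) +
          Real.exp (-(κ * C.d X)) * ((4 * clip k * B₀ k + B₀ k / (R₀ - s₀) * qT k) * |g k - g' k|) :=
        add_le_add (h3 U) (h3 U₀)
    _ = Real.exp (-(κ * C.d X)) * ((8 * clip k * B₀ k + 2 * B₀ k / (R₀ - s₀) * qT k) * |g k - g' k|) := by ring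

/-! ## §2 END-TO-END: NE9 ∧ FADING MEMORY, vacuum-subtracted representation, table constant `2/(R₀ − s₀)` -/

/-- [folklore] **NE9 ∧ FADING MEMORY, VACUUM-SUBTRACTED REPRESENTATION, TABLE CONSTANT `c_eff = 2`** — END #1's
`NE9VacuumSubtractedBridge.ne9_and_fadingMemory_of_couplingTwoPoint_vacSub` with the binder list VERBATIM plus the three displayed letters (`hKP`,
`hsR`, `h𝒜`), `hlipb`∕`lipbar` GONE, `hpos` re-lettered: moduli `Λ k i = ℓ·ω′^{k−1−i}`, `ℓ = 8·clipbar·B + 2·B/(R₀ − s₀)·qTbar`,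
`ω′ = ω + 2·B/(R₀ − s₀)·τ̄` (END #1's: `ℓ = 8·clipbar·B + 8·lipbar·B·qTbar`, `ω′ = ω + 8·lipbar·B·τ̄`); §1 and p256132's `outputLipschitz_of_potentialKPG_sharp_vac` ∘ `outerLipschitz_of_factorisation`
∘ `T4HistoryLipschitzRecursion.ne9_and_fadingMemory_of_perStepNN`.  Every analytic input is a displayed binder; nothing printed is asserted. -/
theorem ne9_and_fadingMemory_of_couplingTwoPoint_vacSub_sharp {ι : Type} {E : Functional C Bg}
    {W : Set (ℕ → ℝ)} {Adm : Set (Bg → C.Dom → ℝ)} {T : ℕ → (ℕ → ℝ) → (Bg → C.Dom → ℝ) → ι → ℝ}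
    {Ψ : ℕ → ℝ → (ι → ℝ) → Bg → C.Dom → ℝ} {act : ℕ → ℝ → Bg → Pot → G.P → ℂ} {𝒜 : ℕ → Set Pot}
    {n m : ℕ → ℝ → Bg → G.P → ℝ} {lip clip : ℕ → ℝ} {a d : G.P → ℝ} {δ : C.Dom → ℝ}
    {κ B clipbar qTbar τbar ω s₀ R₀ : ℝ} {wt : ℕ → ι → ℝ} {τ : ℕ → ℕ → ℝ} {qT : ℕ → ℝ}
    (ρ : ℕ → (ι → ℝ) → Pot) (U₀ : Bg) (explZ : ℕ → Bg → C.Dom → ℝ) (h0 : ScaleZeroFree E W)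
    (hAdm : AdmissibleTerms E W Adm) (hres : AdmRestrict Adm) (hadd : ChannelAdditive Adm T)
    (hsum : ChannelStepSum Adm T) (hstep : ChannelSizeAtStepNN Adm T κ wt τ) (hfac : Factorises E W T Ψ)
    (hclip0 : ∀ k, 0 ≤ clip k)
    (hCup : ∀ g ∈ W, ∀ g' ∈ W, ∀ (k : ℕ) (U : Bg) (X : C.Dom), C.scale X = k + 1 → ∀ Q ∈ 𝒜 k, ∀ γ ∈ G.vol X,
      ‖act k (g k) U Q γ‖ ≤ n k (g' k) U γ ∧
        ‖act k (g k) U Q γ - act k (g' k) U Q γ‖ ≤ clip k * |g k - g' k| * n k (g' k) U γ)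
    (hqT0 : ∀ k, 0 ≤ qT k)
    (hTcup : ∀ g ∈ W, ∀ g' ∈ W, ∀ (k : ℕ) (y : ι), |T k g (E g) y - T k g' (E g) y| ≤ wt k y * (qT k * |g k - g' k|))
    (hreprV : ∀ (k : ℕ) (s : ℝ) (P : ι → ℝ) (U : Bg) (X : C.Dom),
      Ψ k s P U X = (G.newTerm act k s U X (ρ k P)).re - (G.newTerm act k s U₀ X (ρ k P)).re + explZ k U X)
    (hclipb : ∀ k, clip k ≤ clipbar) (hqTb : ∀ k, qT k ≤ qTbar)
    (hK : TwoPointKP G W act 𝒜 n lip a d) (hKP : G.PotentialKPG W act m a d R₀) (hsR : s₀ < R₀)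
    (h𝒜 : ∀ k, 𝒜 k ⊆ closedBall (0 : Pot) s₀) (hdec : G.DecayExtract δ d) (hpin : G.PinBudget a δ (fun _ => B) κ)
    (hρ : ∀ (k : ℕ) (P P' : ι → ℝ) (M : ℝ), (∀ y, |P y - P' y| ≤ wt k y * M) → ‖ρ k P - ρ k P'‖ ≤ M)
    (hocc : ∀ g ∈ W, ∀ g' ∈ W, ∀ k : ℕ, ρ k (T k g' (E g)) ∈ 𝒜 k) (hB : 0 ≤ B) (hτbar : 0 ≤ τbar) (hω : 0 ≤ ω)
    (hpos : 0 < ω + 2 * B / (R₀ - s₀) * τbar) (hτ : ∀ k j, j ≤ k → 0 ≤ τ k j ∧ τ k j ≤ τbar * ω ^ (k - j)) :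
    NE9 E W κ (prodModuli (8 * clipbar * B + 2 * B / (R₀ - s₀) * qTbar) fun _ => ω + 2 * B / (R₀ - s₀) * τbar) ∧
      FadingMemory ((8 * clipbar * B + 2 * B / (R₀ - s₀) * qTbar) / (ω + 2 * B / (R₀ - s₀) * τbar))
        (ω + 2 * B / (R₀ - s₀) * τbar)
        (prodModuli (8 * clipbar * B + 2 * B / (R₀ - s₀) * qTbar) fun _ => ω + 2 * B / (R₀ - s₀) * τbar) := by
  have hlast := lastCouplingLipschitz_of_couplingTwoPoint_vacSub_sharp G ρ U₀ explZ hK hKP hsR h𝒜 hclip0 hCup hdec hpin hρ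
    hreprV hqT0 hTcup hocc
  have hoccn : ∀ g ∈ W, ∀ g' ∈ W, ∀ k : ℕ, ‖ρ k (T k g' (E g))‖ ≤ s₀ := fun g hg g' hg' k =>
    mem_closedBall_zero_iff.1 (h𝒜 k (hocc g hg g' hg' k))
  have hout := outputLipschitz_of_potentialKPG_sharp_vac G ρ hKP hdec hpin hsR hρ hreprV hoccn
  have houter := outerLipschitz_of_factorisation hfac hlast hout
  have hϱ : 0 < R₀ - s₀ := sub_pos.mpr hsR
  have hclipbar : 0 ≤ clipbar := (hclip0 0).trans (hclipb 0)
  have hqTbar : 0 ≤ qTbar := (hqT0 0).trans (hqTb 0)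
  have hc : 0 ≤ 2 * B / (R₀ - s₀) := by positivity
  have hℓ : 0 ≤ 8 * clipbar * B + 2 * B / (R₀ - s₀) * qTbar := by positivity
  have hlam : ∀ k, 8 * clip k * B + 2 * B / (R₀ - s₀) * qT k ≤ 8 * clipbar * B + 2 * B / (R₀ - s₀) * qTbar := by
    intro k
    have h1 : 8 * clip k * B ≤ 8 * clipbar * B := by gcongr; exact hclipb k
    have h3 : 2 * B / (R₀ - s₀) * qT k ≤ 2 * B / (R₀ - s₀) * qTbar := mul_le_mul_of_nonneg_left (hqTb k) hc
    linarith
  exact ne9_and_fadingMemory_of_perStepNN h0 hAdm hres hadd hsum hstep houter hℓ hc hτbar hω hpos hlam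
    (fun _ => ⟨hc, le_rfl⟩) hτ

/-! ## §3 The vacuum-subtracted END at `c_eff = 2` with the occupation DERIVED (twin of `NE9BridgeSizeInduction` §3) -/

/-- [folklore] **NE9 ∧ FADING MEMORY ∧ THE TERM SIZE BOUND, occupation DERIVED, vacuum-subtracted representation, table constant `c_eff = 2`** —
`NE9BridgeSizeInduction.ne9_and_fadingMemory_of_couplingTwoPoint_vacSub_sizeInduction`'s binder list VERBATIM plus (`hKP`, `hsR`, `h𝒜`),
`hlipb`∕`lipbar` GONE, `hpos` re-lettered: the occupation `hocc` is DERIVED by `NE9BridgeSizeInduction.termSize_of_recursion_vacSub` from (B0) `hbase`,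
(XZ) `hexplZ`, (N′) `hNsucc : p₀ j + 2B ≤ N (j+1)`, `hNnn`, (R′) `hbox` (sizes through `TwoPointKP` as in END #1), then §2.  At the record
(`NE9EndApplied`: `Ψ := ΨOf`, `𝒜 := admOf …`, `ρ := readingρ wt`) `hreprV` is D6's `psiOf_eq_vac` (`rfl`) and `h𝒜` is the refuter's occupancy
inclusion `admOf … k ⊆ closedBall 0 s₀` (PRICING-NE9 v8 C8-3) — displayed, discharged by nobody here. -/
theorem ne9_and_fadingMemory_of_couplingTwoPoint_vacSub_sizeInduction_sharp {ι : Type} {E : Functional C Bg}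
    {W : Set (ℕ → ℝ)} {Adm : Set (Bg → C.Dom → ℝ)} {T : ℕ → (ℕ → ℝ) → (Bg → C.Dom → ℝ) → ι → ℝ}
    {Ψ : ℕ → ℝ → (ι → ℝ) → Bg → C.Dom → ℝ} {act : ℕ → ℝ → Bg → Pot → G.P → ℂ} {𝒜 : ℕ → Set Pot}
    {n m : ℕ → ℝ → Bg → G.P → ℝ} {lip clip : ℕ → ℝ} {a d : G.P → ℝ} {δ : C.Dom → ℝ}
    {κ B clipbar qTbar τbar ω s₀ R₀ : ℝ} {wt : ℕ → ι → ℝ} {τ : ℕ → ℕ → ℝ} {qT p₀ N : ℕ → ℝ}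
    (ρ : ℕ → (ι → ℝ) → Pot) (U₀ : Bg) (explZ : ℕ → Bg → C.Dom → ℝ) (h0 : ScaleZeroFree E W)
    (hAdm : AdmissibleTerms E W Adm) (hres : AdmRestrict Adm) (hadd : ChannelAdditive Adm T)
    (hsum : ChannelStepSum Adm T) (hstep : ChannelSizeAtStepNN Adm T κ wt τ) (hfac : Factorises E W T Ψ)
    (hclip0 : ∀ k, 0 ≤ clip k)
    (hCup : ∀ g ∈ W, ∀ g' ∈ W, ∀ (k : ℕ) (U : Bg) (X : C.Dom), C.scale X = k + 1 → ∀ Q ∈ 𝒜 k, ∀ γ ∈ G.vol X,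
      ‖act k (g k) U Q γ‖ ≤ n k (g' k) U γ ∧
        ‖act k (g k) U Q γ - act k (g' k) U Q γ‖ ≤ clip k * |g k - g' k| * n k (g' k) U γ)
    (hqT0 : ∀ k, 0 ≤ qT k)
    (hTcup : ∀ g ∈ W, ∀ g' ∈ W, ∀ (k : ℕ) (y : ι), |T k g (E g) y - T k g' (E g) y| ≤ wt k y * (qT k * |g k - g' k|))
    (hreprV : ∀ (k : ℕ) (s : ℝ) (P : ι → ℝ) (U : Bg) (X : C.Dom),
      Ψ k s P U X = (G.newTerm act k s U X (ρ k P)).re - (G.newTerm act k s U₀ X (ρ k P)).re + explZ k U X)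
    (hclipb : ∀ k, clip k ≤ clipbar) (hqTb : ∀ k, qT k ≤ qTbar)
    (hK : TwoPointKP G W act 𝒜 n lip a d) (hKP : G.PotentialKPG W act m a d R₀) (hsR : s₀ < R₀)
    (h𝒜 : ∀ k, 𝒜 k ⊆ closedBall (0 : Pot) s₀) (hdec : G.DecayExtract δ d) (hpin : G.PinBudget a δ (fun _ => B) κ)
    (hρ : ∀ (k : ℕ) (P P' : ι → ℝ) (M : ℝ), (∀ y, |P y - P' y| ≤ wt k y * M) → ‖ρ k P - ρ k P'‖ ≤ M)
    -- the size-induction data (B0), (XZ), (N′), (R′) — in place of the occupation hypothesis `hocc`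
    (hexplZ : ∀ (k : ℕ) (U : Bg) (X : C.Dom), C.scale X = k + 1 → |explZ k U X| ≤ Real.exp (-(κ * C.d X)) * p₀ k)
    (hbase : ∀ g ∈ W, ∀ (U : Bg) (X : C.Dom), C.scale X = 0 → |E g U X| ≤ Real.exp (-(κ * C.d X)) * N 0)
    (hNsucc : ∀ j, p₀ j + 2 * B ≤ N (j + 1)) (hNnn : ∀ j, 0 ≤ N j)
    (hbox : ∀ (k : ℕ) (P : ι → ℝ), (∀ y, |P y| ≤ wt k y * sizeRadius τ N k) → ρ k P ∈ 𝒜 k)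
    (hB : 0 ≤ B) (hτbar : 0 ≤ τbar) (hω : 0 ≤ ω) (hpos : 0 < ω + 2 * B / (R₀ - s₀) * τbar)
    (hτ : ∀ k j, j ≤ k → 0 ≤ τ k j ∧ τ k j ≤ τbar * ω ^ (k - j)) :
    TermSize E W κ N ∧
      NE9 E W κ (prodModuli (8 * clipbar * B + 2 * B / (R₀ - s₀) * qTbar) fun _ => ω + 2 * B / (R₀ - s₀) * τbar) ∧
        FadingMemory ((8 * clipbar * B + 2 * B / (R₀ - s₀) * qTbar) / (ω + 2 * B / (R₀ - s₀) * τbar))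
          (ω + 2 * B / (R₀ - s₀) * τbar)
          (prodModuli (8 * clipbar * B + 2 * B / (R₀ - s₀) * qTbar) fun _ => ω + 2 * B / (R₀ - s₀) * τbar) := by
  obtain ⟨hT, hocc⟩ := termSize_of_recursion_vacSub G ρ U₀ explZ hAdm (channelSizeNN_of_perStepNN hres hsum hstep) hfac hK
    hdec hpin hreprV hexplZ hbase hNsucc hNnn hbox
  exact ⟨hT, ne9_and_fadingMemory_of_couplingTwoPoint_vacSub_sharp G ρ U₀ explZ h0 hAdm hres hadd hsum hstep hfac hclip0 hCup
    hqT0 hTcup hreprV hclipb hqTb hK hKP hsR h𝒜 hdec hpin hρ hocc hB hτbar hω hpos hτ⟩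

end Bridge

/-! ## §4 Junction with the record: §3 at `Ψ := NE9EndApplied.ΨOf` -/

section Record

open Summit.QuantumFields.BalabanUV.T4Continuum.NE9EndApplied
open Summit.QuantumFields.BalabanUV.T4Continuum.NE9TableReading
open Summit.QuantumFields.BalabanUV.T4Continuum.NE9ComplexEncoding (doubleCarriers)

variable {C₀ : Carriers} {E : Type} {ι : Type}

/-- [folklore] **END #1's ARCHITECTURE AT THE FLOOR, AT THE RECORD's OWN NEW-TERM MAP `ΨOf`** (reading `readingρ wt`): §3 at
`Ψ := NE9EndApplied.ΨOf G act wt U₀ explZ` with `hreprV` discharged by `rfl` — the twin of p256132's `ne9_and_fadingMemory_of_potentialKPG_psiOf`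
in which the coupling half (L) is DERIVED from the displayed coupling two-point data (`hK`, `hCup`, `hTcup`) and the occupation from the size data
(`hexplZ`, `hbase`, `hNsucc`, `hNnn`, `hbox`); the reading's 1-Lipschitz property stays DISPLAYED as `hρ` (consumers pass `NE9TableReading`'s lemma).
For ANY functional on the re∕im-doubled carriers factorising through a channel with this new-term map (e.g. `EfOf` via `factorises_EfOf`). -/
theorem ne9_and_fadingMemory_of_couplingTwoPoint_vacSub_sizeInduction_psiOf (G : ClusterGeom (doubleCarriers C₀))
    {Ef : Functional (doubleCarriers C₀) E} {W : Set (ℕ → ℝ)} {Adm : Set (E → (doubleCarriers C₀).Dom → ℝ)}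
    {T : ℕ → (ℕ → ℝ) → (E → (doubleCarriers C₀).Dom → ℝ) → ι → ℝ} {act : ℕ → ℝ → E → lp (fun _ : ι => ℂ) ∞ → G.P → ℂ}
    {𝒜 : ℕ → Set (lp (fun _ : ι => ℂ) ∞)} {n m : ℕ → ℝ → E → G.P → ℝ} {lip clip : ℕ → ℝ} {a d : G.P → ℝ}
    {δ : (doubleCarriers C₀).Dom → ℝ} {κ B clipbar qTbar τbar ω s₀ R₀ : ℝ} {wt : ℕ → ι → ℝ} {τ : ℕ → ℕ → ℝ} {qT p₀ N : ℕ → ℝ}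
    {U₀ : E} {explZ : ℕ → E → (doubleCarriers C₀).Dom → ℝ} (h0 : ScaleZeroFree Ef W) (hAdm : AdmissibleTerms Ef W Adm)
    (hres : AdmRestrict Adm) (hadd : ChannelAdditive Adm T) (hsum : ChannelStepSum Adm T) (hstep : ChannelSizeAtStepNN Adm T κ wt τ)
    (hfac : Factorises Ef W T (ΨOf G act wt U₀ explZ)) (hclip0 : ∀ k, 0 ≤ clip k)
    (hCup : ∀ g ∈ W, ∀ g' ∈ W, ∀ (k : ℕ) (U : E) (X : (doubleCarriers C₀).Dom), (doubleCarriers C₀).scale X = k + 1 →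
      ∀ Q ∈ 𝒜 k, ∀ γ ∈ G.vol X, ‖act k (g k) U Q γ‖ ≤ n k (g' k) U γ ∧
        ‖act k (g k) U Q γ - act k (g' k) U Q γ‖ ≤ clip k * |g k - g' k| * n k (g' k) U γ)
    (hqT0 : ∀ k, 0 ≤ qT k)
    (hTcup : ∀ g ∈ W, ∀ g' ∈ W, ∀ (k : ℕ) (y : ι), |T k g (Ef g) y - T k g' (Ef g) y| ≤ wt k y * (qT k * |g k - g' k|))
    (hclipb : ∀ k, clip k ≤ clipbar) (hqTb : ∀ k, qT k ≤ qTbar) (hK : TwoPointKP G W act 𝒜 n lip a d)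
    (hKP : G.PotentialKPG W act m a d R₀) (hsR : s₀ < R₀) (h𝒜 : ∀ k, 𝒜 k ⊆ closedBall (0 : lp (fun _ : ι => ℂ) ∞) s₀)
    (hdec : G.DecayExtract δ d) (hpin : G.PinBudget a δ (fun _ => B) κ)
    (hρ : ∀ (k : ℕ) (P P' : ι → ℝ) (M : ℝ), (∀ y, |P y - P' y| ≤ wt k y * M) →
      ‖readingρ wt k P - readingρ wt k P'‖ ≤ M)
    (hexplZ : ∀ (k : ℕ) (U : E) (X : (doubleCarriers C₀).Dom), (doubleCarriers C₀).scale X = k + 1 →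
      |explZ k U X| ≤ Real.exp (-(κ * (doubleCarriers C₀).d X)) * p₀ k)
    (hbase : ∀ g ∈ W, ∀ (U : E) (X : (doubleCarriers C₀).Dom), (doubleCarriers C₀).scale X = 0 →
      |Ef g U X| ≤ Real.exp (-(κ * (doubleCarriers C₀).d X)) * N 0)
    (hNsucc : ∀ j, p₀ j + 2 * B ≤ N (j + 1)) (hNnn : ∀ j, 0 ≤ N j)
    (hbox : ∀ (k : ℕ) (P : ι → ℝ), (∀ y, |P y| ≤ wt k y * sizeRadius τ N k) → readingρ wt k P ∈ 𝒜 k)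
    (hB : 0 ≤ B) (hτbar : 0 ≤ τbar) (hω : 0 ≤ ω) (hpos : 0 < ω + 2 * B / (R₀ - s₀) * τbar)
    (hτ : ∀ k j, j ≤ k → 0 ≤ τ k j ∧ τ k j ≤ τbar * ω ^ (k - j)) :
    TermSize Ef W κ N ∧
      NE9 Ef W κ (prodModuli (8 * clipbar * B + 2 * B / (R₀ - s₀) * qTbar) fun _ => ω + 2 * B / (R₀ - s₀) * τbar) ∧
        FadingMemory ((8 * clipbar * B + 2 * B / (R₀ - s₀) * qTbar) / (ω + 2 * B / (R₀ - s₀) * τbar))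
          (ω + 2 * B / (R₀ - s₀) * τbar)
          (prodModuli (8 * clipbar * B + 2 * B / (R₀ - s₀) * qTbar) fun _ => ω + 2 * B / (R₀ - s₀) * τbar) :=
  ne9_and_fadingMemory_of_couplingTwoPoint_vacSub_sizeInduction_sharp G (readingρ wt) U₀ explZ h0 hAdm hres hadd hsum hstep hfac
    hclip0 hCup hqT0 hTcup (fun _ _ _ _ _ => rfl) hclipb hqTb hK hKP hsR h𝒜 hdec hpin hρ hexplZ hbase hNsucc hNnn hbox hB hτbar
    hω hpos hτ

end Record

end Summit.QuantumFields.BalabanUV.T4Continuum.NE9VacuumSubtractedBridgeSharp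

end
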